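import Summits.BirchSwinnertonDyer.Rank1Residual.X11b.Three.LambdaSupplyQuotient
import Summits.BirchSwinnertonDyer.Rank1Residual.X11b.Three.LambdaSupplyAvatar
import Summits.Langlands.Langlands.Theorems.IrreducibilityBySelfDualityReciprocityUpToIrreducibilityHeckeTypeZeroFiniteOrder
import Literature.NumberTheory.GaloisRepresentations.WeakAbelianDirectSummandProofs
import HarnessLib

/-!
# X11b @ `p = 3`, S28-c (K2) 'TWIST-SUPPLY', part 1: characters through the anticyclotomic `Γ⁻` —
# anti-invariance, rigidity, `𝕀_ℚ`-triviality, `p`-power order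

HONEST FRAMING (cell `b2b-bsdres`, run/shared/lean/b2b/bsd-rank1-residual/, verbatim in every
file): the goal of the cell is to DELETE the COMBINATION-SHAPED residual classes of the
Birch–Swinnerton-Dyer formula for ALL analytic-rank `≤ 1` elliptic curves over `ℚ` — assembled
STRICTLY from published theorems — so that the rank-`≤ 1` remainder becomes exactly the
CONSTRUCTION-SHAPED classes, which are TYPED, NOT attempted. This is not "finishing BSD". Team N8/O2
(X11b at `3`: `3 ‖ N`, `r_an = 1`, `E[3]` irreducible): research route; nothing booked; NO label
changes; O2 stays OPEN; S28 RE-EXPRESSES the descent node `Three.HsiehDescentAt₃` (a READING — H45: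
nothing 'shrinks'). THEOREMS ONLY (Galois/Hecke bookkeeping over PROVED tree infrastructure); no
definition, no fact, no `sorry`. 'Admissible' is SPELLED OUT each time as the six clauses
[08]–[13] of `hsieh2014_exists_anticyclotomicPAdicLFunction`; the twist 'ε' is a PAIR
`(μ, r_μ)` (Hecke character, rank-one framed `p`-adic representation).

PROVENANCE: sub-target S28 'COMMON-FRAME RE-EXPRESSION OF THE DESCENT NODE', piece **S28-c =
(K2) 'twist-supply'** (lead GEN 7 R8-18 / R8-22 (d) / INBOX 2026-08-21 12:48Z nominal), seat
`b2b-bsdres-x11b3-p2` (gen. 4); intended signatures posted before proving (HOME/INBOX.md, same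
seat). Inputs: this seat's S24-a (C) files `LambdaSupplyTransport` / `LambdaSupplyQuotient`,
p7's (B) `LambdaSupplyAvatar` (`hasInfinityType_zero_of_isFiniteOrder`), the Langlands-side tree
theorem `stub_isFiniteOrder_of_hasInfinityType_zero` (Neukirch VII (6.9)/(6.14): type `(0,0)` ⇒
finite order) and Hecke rigidity `HeckeCharacter.eq_of_hasFrobCharpolyAt_eventually`
(`WeakAbelianDirectSummandProofs`).

## What this file proves (`K` a number field, `[K:ℚ] = 2` Galois where stated; `p` prime, odd where
## stated; `ι : ℚ̄_p ≃ ℂ`; `κ : Γ_K ↠ ℤ_p`; `e = FramedRep.unitsContinuousMulEquivOfUnique (Fin 1) ℚ̄_p`)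

* §1 `apply_eq_inv_of_factorsThroughZp` (**K2-d**): `r` through `κ`, `κ(θσ) = κ(σ)⁻¹` ⇒
  `r(θσ) = r(σ)⁻¹`; `isAnticyclotomic_apply_absGaloisOuterConj`: the tree's `IsAnticyclotomic` at
  the outer action `θ_c` of any `c ∈ Γ_ℚ ∖ res(Γ_K)`.
* §2 `eq_of_isPAdicAvatarOf_of_isPAdicAvatarOf`: two Hecke characters unramified outside `p` with
  a common avatar are EQUAL.
* §3 `galConj_eq_inv_of_factorsThroughZp` (`χ ∘ c̄ = χ⁻¹` when the avatar factors through an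
  anticyclotomic `κ`) and **`apply_ideleBaseChange_eq_one_of_pow_eq_one` (K2-c)**: a Hecke character of
  `p`-power order (`p` odd), unramified outside `p`, with avatar through an anticyclotomic `κ`, is
  trivial on `𝕀_ℚ` (`χ(x_ℚ) = χ(x_ℚ)⁻¹` and `χ(x_ℚ)^{p^k} = 1`).
* §4 the trivial character / powers: `isUnramifiedAt_one'`, `isUnramifiedAt_pow'`,
  `valueAtUniformizer_one'`, `isPAdicAvatarOf_one`, `isPAdicAvatarOf_pow`.
* §5 `pow_ordProj_eq_one_of_factorsThroughZp` (a character through `κ` killed by `N ≠ 0` is killed by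
  `p^{v_p(N)}`: `κ` is onto `ℤ_p`, in which the prime-to-`p` part of `N` is a unit) and
  `exists_pow_prime_pow_eq_one` (a finite-order Hecke character unramified outside `p` whose avatar
  factors through `κ` has `p`-POWER order — two rigidity round trips).
* §6–§7 ((K2-a) `twist_admissible`, (K2-b) `quotient_admissible`) are the sequel file
  `X11b/Three/LambdaSupplyTwistOrbit.lean`.

## References

* R. Greenberg, *Non-vanishing of certain values of `L`-functions*, Progr. Math. 70 (1987), §2
  (anticyclotomic characters: `χ ∘ c = χ⁻¹`). [Greenberg1987]
* J. Neukirch, *Algebraic Number Theory* (1999), Ch. VII §6, Prop. (6.9), Cor. (6.14) (type `(0,0)`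
  characters have finite order). [NeukirchANT1999]
* J. W. S. Cassels, A. Fröhlich (eds.), *Algebraic Number Theory* (1967), Ch. VII §4, Prop. 4.1
  (a Hecke character is determined by almost all Frobenius values). [CasselsFrohlichANT1967]
* M.-L. Hsieh, *Special values of anticyclotomic Rankin–Selberg L-functions*, Doc. Math. 19
  (2014), Thm. 1 (the admissible `λ`). [Hsieh2014]
-/

noncomputable section

open scoped NumberField Polynomial
open NumberField IsDedekindDomain Field Polynomial Filter
  Literature.NumberTheory.GaloisRepresentations Literature.NumberTheory.EllipticCurves
  Literature.NumberTheory.Automorphic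

namespace Summit.BirchSwinnertonDyer.Rank1Residual.X11b.Three.LambdaSupply

variable {K : Type} [Field K] [NumberField K] {p : ℕ} [Fact p.Prime]

/-! ### §1. Characters through an anticyclotomic `ℤ_p`-extension are anti-invariant -/

omit [NumberField K] in
/-- **(K2-d)** If `r` factors through `κ` (kills `ker κ`) and `κ` is anticyclotomic at `θ`
(`κ (θ σ) = (κ σ)⁻¹`), then `r (θ σ) = (r σ)⁻¹`: indeed `θσ · σ ∈ ker κ`. [folklore] -/
theorem apply_eq_inv_of_factorsThroughZp {A : Type*} [CommRing A] [TopologicalSpace A]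
    {κ : ZpExtension K p} {r : FramedGaloisRep K A 1} (hr : FactorsThroughZp κ r)
    {θ : absoluteGaloisGroup K →ₜ* absoluteGaloisGroup K} (hκθ : ∀ σ, κ (θ σ) = (κ σ)⁻¹)
    (σ : absoluteGaloisGroup K) : r (θ σ) = (r σ)⁻¹ := by
  have h1 : κ (θ σ * σ) = 1 := by rw [map_mul, hκθ, inv_mul_cancel]
  have h2 : r (θ σ * σ) = 1 := hr _ h1
  rw [map_mul] at h2
  exact eq_inv_of_mul_eq_one_left h2

/-- The anticyclotomic condition of the tree (`ZpExtension.IsAnticyclotomic`) at the outer action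
`θ_c` of any `c ∈ Γ_ℚ ∖ res(Γ_K)`: `κ (θ_c σ) = (κ σ)⁻¹`. [folklore] -/
theorem isAnticyclotomic_apply_absGaloisOuterConj [IsGalois ℚ K] {κ : ZpExtension K p}
    (hκ : κ.IsAnticyclotomic) {c : absoluteGaloisGroup ℚ}
    (hc : c ∉ Set.range (absGaloisRestrict ℚ K)) (σ : absoluteGaloisGroup K) :
    κ (absGaloisOuterConj ℚ K c σ) = (κ σ)⁻¹ :=
  hκ σ _ c hc (absGaloisRestrict_absGaloisOuterConj ℚ K c σ)

/-! ### §2. Rigidity of the Hecke character given the avatar -/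

/-- **Two Hecke characters unramified outside `p` with a common `p`-adic avatar are equal**
(Frobenius values at almost all places determine a Hecke character:
`HeckeCharacter.eq_of_hasFrobCharpolyAt_eventually`, Cassels–Fröhlich VII Prop. 4.1). [folklore] -/
theorem eq_of_isPAdicAvatarOf_of_isPAdicAvatarOf (ι : PadicAlgCl p ≃+* ℂ) {χ₁ χ₂ : HeckeCharacter K}
    {r : FramedGaloisRep K (PadicAlgCl p) 1} (h₁ : IsPAdicAvatarOf ι χ₁ r)
    (h₂ : IsPAdicAvatarOf ι χ₂ r)
    (hu₁ : ∀ v : HeightOneSpectrum (𝓞 K), ((p : ℕ) : 𝓞 K) ∉ v.asIdeal → χ₁.IsUnramifiedAt v)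
    (hu₂ : ∀ v : HeightOneSpectrum (𝓞 K), ((p : ℕ) : 𝓞 K) ∉ v.asIdeal → χ₂.IsUnramifiedAt v) :
    χ₁ = χ₂ := by
  have hp0 : ((p : ℕ) : 𝓞 K) ≠ 0 := Nat.cast_ne_zero.2 (Fact.out : p.Prime).ne_zero
  have hfin : ∀ᶠ v : HeightOneSpectrum (𝓞 K) in cofinite, ((p : ℕ) : 𝓞 K) ∉ v.asIdeal := by
    refine eventually_cofinite.mpr ?_
    simpa only [not_not] using HeckeCharacter.finite_setOf_mem_asIdeal hp0
  refine HeckeCharacter.eq_of_hasFrobCharpolyAt_eventually r ι (hfin.mono fun v hv => ?_)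
    (hfin.mono fun v hv => ?_)
  · have := (h₁ v hv (hu₁ v hv)).2; rwa [← map_inv₀] at this
  · have := (h₂ v hv (hu₂ v hv)).2; rwa [← map_inv₀] at this

/-! ### §3. (K2-c): a `p`-power-order character through the anticyclotomic `Γ⁻` is trivial on `𝕀_ℚ` -/

/-- **`χ ∘ c = χ⁻¹` for a Hecke character whose avatar factors through an anticyclotomic
`ℤ_p`-extension** (`K` imaginary quadratic, `χ` unramified outside `p`): the avatar of `χ ∘ c̄`
is `r ∘ θ_c = r⁻¹` (transport + (K2-d)), which is the avatar of `χ⁻¹`; rigidity. [folklore] -/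
theorem galConj_eq_inv_of_factorsThroughZp [IsGalois ℚ K] (ι : PadicAlgCl p ≃+* ℂ)
    {κ : ZpExtension K p} (hκ : κ.IsAnticyclotomic) {c : absoluteGaloisGroup ℚ}
    (hc : c ∉ Set.range (absGaloisRestrict ℚ K)) {χ : HeckeCharacter K}
    {r : FramedGaloisRep K (PadicAlgCl p) 1} (hr : IsPAdicAvatarOf ι χ r) (hκr : FactorsThroughZp κ r)
    (hχ : ∀ v : HeightOneSpectrum (𝓞 K), ((p : ℕ) : 𝓞 K) ∉ v.asIdeal → χ.IsUnramifiedAt v) :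
    HeckeCharacter.galConj (absGaloisQuot ℚ K c) χ = χ⁻¹ := by
  -- write `r = e ∘ ψ`
  set ψ : absoluteGaloisGroup K →ₜ* (PadicAlgCl p)ˣ :=
    ((FramedRep.unitsContinuousMulEquivOfUnique (Fin 1) (PadicAlgCl p)).symm :
      GL (Fin 1) (PadicAlgCl p) →ₜ* (PadicAlgCl p)ˣ).comp r with hψ
  have hre : (FramedRep.unitsContinuousMulEquivOfUnique (Fin 1) (PadicAlgCl p) :
      (PadicAlgCl p)ˣ →ₜ* GL (Fin 1) (PadicAlgCl p)).comp ψ = r := by rw [hψ, comp_symm_comp_eq]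
  have hr' : IsPAdicAvatarOf ι χ ((FramedRep.unitsContinuousMulEquivOfUnique (Fin 1) (PadicAlgCl p) :
      (PadicAlgCl p)ˣ →ₜ* GL (Fin 1) (PadicAlgCl p)).comp ψ) := by rwa [hre]
  -- the avatar of `χ ∘ c̄` is `e ∘ (ψ ∘ θ)`, and `ψ ∘ θ = ψ⁻¹`
  have hanti : ∀ σ, r (absGaloisOuterConj ℚ K c σ) = (r σ)⁻¹ :=
    apply_eq_inv_of_factorsThroughZp hκr (isAnticyclotomic_apply_absGaloisOuterConj hκ hc)
  have hθψ : ψ.comp (absGaloisOuterConj ℚ K c) = ψ⁻¹ := by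
    refine ContinuousMonoidHom.ext fun σ => ?_
    rw [ContinuousMonoidHom.coe_comp, Function.comp_apply, unitsChar_inv_apply, hψ,
      ContinuousMonoidHom.coe_comp, Function.comp_apply, Function.comp_apply, hanti, map_inv]
  have h1 : IsPAdicAvatarOf ι (HeckeCharacter.galConj (absGaloisQuot ℚ K c) χ)
      ((FramedRep.unitsContinuousMulEquivOfUnique (Fin 1) (PadicAlgCl p) :
        (PadicAlgCl p)ˣ →ₜ* GL (Fin 1) (PadicAlgCl p)).comp ψ⁻¹) := by
    rw [← hθψ, ← outerConj_unitsChar]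
    exact isPAdicAvatarOf_galConj_outerConj ι hr' c
  have h2 : IsPAdicAvatarOf ι χ⁻¹ ((FramedRep.unitsContinuousMulEquivOfUnique (Fin 1) (PadicAlgCl p) :
        (PadicAlgCl p)ˣ →ₜ* GL (Fin 1) (PadicAlgCl p)).comp ψ⁻¹) := isPAdicAvatarOf_inv ι hr'
  exact eq_of_isPAdicAvatarOf_of_isPAdicAvatarOf ι h1 h2
    (isUnramifiedAt_galConj_of_forall _ hχ) (fun v hv => (hχ v hv).inv')

/-- **(K2-c) A Hecke character of `p`-power order (`p` odd), unramified outside `p`, whose `p`-adic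
avatar factors through an anticyclotomic `ℤ_p`-extension, is TRIVIAL ON THE IDELES OF `ℚ`**:
`χ(x_ℚ) = (χ ∘ c)(x_ℚ) = χ(x_ℚ)⁻¹` (`galConj_eq_inv_of_factorsThroughZp`, `AdeleRing.smul_ideleBaseChange`),
so `χ(x_ℚ)² = 1 = χ(x_ℚ)^{p^k}`. [folklore] -/
theorem apply_ideleBaseChange_eq_one_of_pow_eq_one [IsGalois ℚ K] (hK : Module.finrank ℚ K = 2)
    (hp : p ≠ 2) (ι : PadicAlgCl p ≃+* ℂ) {κ : ZpExtension K p} (hκ : κ.IsAnticyclotomic)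
    {χ : HeckeCharacter K} {r : FramedGaloisRep K (PadicAlgCl p) 1} (hr : IsPAdicAvatarOf ι χ r)
    (hκr : FactorsThroughZp κ r)
    (hχ : ∀ v : HeightOneSpectrum (𝓞 K), ((p : ℕ) : 𝓞 K) ∉ v.asIdeal → χ.IsUnramifiedAt v)
    {k : ℕ} (hk : χ ^ (p ^ k) = 1) (x : ideleGroup ℚ) :
    χ (AdeleRing.ideleBaseChange ℚ K x) = 1 := by
  -- an element of `Γ_ℚ` outside `res(Γ_K)`: any lift of the non-trivial automorphism of `K`
  obtain ⟨σ, hσ⟩ : ∃ σ : K ≃ₐ[ℚ] K, σ ≠ 1 := by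
    have hcard : Nat.card (K ≃ₐ[ℚ] K) = 2 := by rw [IsGalois.card_aut_eq_finrank, hK]
    haveI : Nontrivial (K ≃ₐ[ℚ] K) := Finite.one_lt_card_iff_nontrivial.mp (by omega)
    exact exists_ne 1
  obtain ⟨c, hcσ⟩ := absGaloisQuot_surjective ℚ K σ
  have hc : c ∉ Set.range (absGaloisRestrict ℚ K) := fun hmem =>
    hσ (by rw [← hcσ]; exact (absGaloisQuot_eq_one_iff ℚ K c).2 (MonoidHom.mem_range.mpr hmem))
  have hconj := galConj_eq_inv_of_factorsThroughZp ι hκ hc hr hκr hχ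
  -- `χ(x_ℚ) = χ(x_ℚ)⁻¹`
  have hsq : χ (AdeleRing.ideleBaseChange ℚ K x) * χ (AdeleRing.ideleBaseChange ℚ K x) = 1 := by
    have := DFunLike.congr_fun hconj (AdeleRing.ideleBaseChange ℚ K x)
    rw [HeckeCharacter.galConj_apply, AdeleRing.smul_ideleBaseChange, HeckeCharacter.inv_apply] at this
    nth_rw 1 [this]
    exact inv_mul_cancel _
  -- `χ(x_ℚ)^{p^k} = 1` with `p^k` odd
  have hpow : χ (AdeleRing.ideleBaseChange ℚ K x) ^ (p ^ k) = 1 := by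
    rw [← HeckeCharacter.pow_apply, hk, HeckeCharacter.one_apply]
  have hodd : Odd (p ^ k) := Odd.pow ((Fact.out : p.Prime).odd_of_ne_two hp)
  obtain ⟨m, hm⟩ := hodd
  rw [hm, pow_succ, pow_mul, sq, hsq, one_pow, one_mul] at hpow
  exact hpow

/-! ### §4. Small closure lemmas: the trivial character, powers -/

omit [NumberField K] in
/-- The trivial Hecke character is unramified everywhere. [folklore] -/
theorem isUnramifiedAt_one' [NumberField K] (v : HeightOneSpectrum (𝓞 K)) :
    (1 : HeckeCharacter K).IsUnramifiedAt v :=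
  HeckeCharacter.isUnramifiedAt_iff_forall_valued_eq_one.mpr fun _ _ => rfl

/-- Powers of a character unramified at `v` are unramified at `v`. [folklore] -/
theorem isUnramifiedAt_pow' {χ : HeckeCharacter K} {v : HeightOneSpectrum (𝓞 K)}
    (h : χ.IsUnramifiedAt v) (n : ℕ) : (χ ^ n).IsUnramifiedAt v := by
  induction n with
  | zero => rw [pow_zero]; exact isUnramifiedAt_one' v
  | succ n ih => rw [pow_succ]; exact ih.mul' h

/-- `(1 : HeckeCharacter K)(ϖ_v) = 1`. [folklore] -/
theorem valueAtUniformizer_one' (v : HeightOneSpectrum (𝓞 K)) :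
    (1 : HeckeCharacter K).valueAtUniformizer v = 1 := by
  simp only [HeckeCharacter.valueAtUniformizer, HeckeCharacter.localComponent_apply,
    HeckeCharacter.one_apply, Units.val_one]

/-- **The trivial character has the trivial avatar** `e ∘ 1`. [folklore] -/
theorem isPAdicAvatarOf_one (ι : PadicAlgCl p ≃+* ℂ) :
    IsPAdicAvatarOf ι (1 : HeckeCharacter K) ((FramedRep.unitsContinuousMulEquivOfUnique (Fin 1) (PadicAlgCl p) :
      (PadicAlgCl p)ˣ →ₜ* GL (Fin 1) (PadicAlgCl p)).comp 1) := by
  rw [isPAdicAvatarOf_unitsChar_iff]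
  intro v _ _
  refine ⟨fun 𝔓 _ σ _ => rfl, fun 𝔓 _ Φ _ => ?_⟩
  rw [valueAtUniformizer_one', map_one, inv_one]
  rfl

/-- **Avatars of powers**: if `e ∘ ψ` is the avatar of `χ` (unramified outside `p`) then `e ∘ ψⁿ`
is the avatar of `χⁿ`. [folklore] -/
theorem isPAdicAvatarOf_pow (ι : PadicAlgCl p ≃+* ℂ) {χ : HeckeCharacter K}
    {ψ : absoluteGaloisGroup K →ₜ* (PadicAlgCl p)ˣ}
    (h : IsPAdicAvatarOf ι χ ((FramedRep.unitsContinuousMulEquivOfUnique (Fin 1) (PadicAlgCl p) :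
      (PadicAlgCl p)ˣ →ₜ* GL (Fin 1) (PadicAlgCl p)).comp ψ))
    (hχ : ∀ v : HeightOneSpectrum (𝓞 K), ((p : ℕ) : 𝓞 K) ∉ v.asIdeal → χ.IsUnramifiedAt v) (n : ℕ) :
    IsPAdicAvatarOf ι (χ ^ n) ((FramedRep.unitsContinuousMulEquivOfUnique (Fin 1) (PadicAlgCl p) :
      (PadicAlgCl p)ˣ →ₜ* GL (Fin 1) (PadicAlgCl p)).comp (ψ ^ n)) := by
  induction n with
  | zero => rw [pow_zero, pow_zero]; exact isPAdicAvatarOf_one ι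
  | succ n ih =>
    rw [pow_succ, pow_succ]
    exact isPAdicAvatarOf_mul ι ih h (hram_of_forall (fun v hv => isUnramifiedAt_pow' (hχ v hv) n) hχ)

/-! ### §5. Finite quotients of `Γ⁻ ≃ ℤ_p` are `p`-groups -/

omit [NumberField K] in
/-- **A character through a `ℤ_p`-extension killed by `N` is killed by the `p`-part of `N`.** If
`g : Γ_K → M` kills `ker κ` and `g^N = 1` (`N ≠ 0`) then `g^{p^{v_p(N)}} = 1`: writing
`N = p^e N'` with `p ∤ N'`, `N'` is a unit of `ℤ_p`, so every `σ` is `τ^{N'}` modulo `ker κ`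
(`κ` is ONTO `ℤ_p`), whence `g(σ)^{p^e} = g(τ)^{N} = 1`. [folklore] -/
theorem pow_ordProj_eq_one_of_factorsThroughZp {M : Type*} [CommGroup M] (κ : ZpExtension K p)
    (g : absoluteGaloisGroup K →* M) (hg : ∀ σ, κ σ = 1 → g σ = 1) {N : ℕ} (hN0 : N ≠ 0)
    (hN : ∀ σ, g σ ^ N = 1) (σ : absoluteGaloisGroup K) : g σ ^ (p ^ N.factorization p) = 1 := by
  have hpp : p.Prime := Fact.out
  set e := N.factorization p with he
  set N' := N / p ^ e with hN'
  have hNN' : p ^ e * N' = N := Nat.ordProj_mul_ordCompl_eq_self N p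
  have hcop : p.Coprime N' := Nat.coprime_ordCompl hpp hN0
  -- `N'` is a unit of `ℤ_p`
  have hunit : IsUnit ((N' : ℕ) : ℤ_[p]) := by
    rw [PadicInt.isUnit_iff]
    refine le_antisymm (PadicInt.norm_le_one _) (not_lt.mp fun hlt => ?_)
    rw [← Int.cast_natCast, PadicInt.norm_int_lt_one_iff_dvd, Int.natCast_dvd_natCast] at hlt
    exact (Nat.Prime.coprime_iff_not_dvd hpp).mp hcop hlt
  obtain ⟨u, hu⟩ := hunit
  -- `σ = τ^{N'}` modulo `ker κ`
  set a : ℤ_[p] := (κ σ).toAdd with ha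
  obtain ⟨τ, hτ⟩ := κ.surjective (Multiplicative.ofAdd ((↑u⁻¹ : ℤ_[p]) * a))
  have hκτ : κ (τ ^ N') = κ σ := by
    change κ.toContinuousMonoidHom (τ ^ N') = _
    rw [map_pow, hτ, ← ofAdd_nsmul, nsmul_eq_mul, ← hu, ← mul_assoc, Units.mul_inv, one_mul, ha,
      ofAdd_toAdd]
  have hker : κ (σ * (τ ^ N')⁻¹) = 1 := by rw [map_mul, map_inv, hκτ, mul_inv_cancel]
  have hgσ : g σ = g τ ^ N' := by
    have := hg _ hker
    rw [map_mul, map_inv, map_pow, mul_inv_eq_one] at this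
    exact this
  rw [hgσ, ← pow_mul, mul_comm, hNN']
  exact hN τ

/-- **A finite-order Hecke character (unramified outside `p`) whose avatar factors through `κ`
has `p`-POWER order.** (`μ^N = 1` ⇒ the avatar `e ∘ ψ` has `ψ^N = 1` by rigidity of avatars ⇒
`ψ^{p^e} = 1` by `pow_ordProj_eq_one_of_factorsThroughZp` ⇒ `μ^{p^e} = 1` by rigidity of the
character.) [folklore] -/
theorem exists_pow_prime_pow_eq_one (ι : PadicAlgCl p ≃+* ℂ) {κ : ZpExtension K p}
    {μ : HeckeCharacter K} {rμ : FramedGaloisRep K (PadicAlgCl p) 1} (hfin : μ.IsFiniteOrder)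
    (hμ11 : ∀ v : HeightOneSpectrum (𝓞 K), ((p : ℕ) : 𝓞 K) ∉ v.asIdeal → μ.IsUnramifiedAt v)
    (hμ12 : IsPAdicAvatarOf ι μ rμ) (hμ13 : FactorsThroughZp κ rμ) :
    ∃ k : ℕ, μ ^ (p ^ k) = 1 := by
  obtain ⟨N, hN0, hμN⟩ := hfin.exists_pow_eq_one
  -- `rμ = e ∘ ψ`
  set ψ : absoluteGaloisGroup K →ₜ* (PadicAlgCl p)ˣ := ((FramedRep.unitsContinuousMulEquivOfUnique (Fin 1) (PadicAlgCl p)).symm :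
      GL (Fin 1) (PadicAlgCl p) →ₜ* (PadicAlgCl p)ˣ).comp rμ with hψ
  have hre : (FramedRep.unitsContinuousMulEquivOfUnique (Fin 1) (PadicAlgCl p) :
      (PadicAlgCl p)ˣ →ₜ* GL (Fin 1) (PadicAlgCl p)).comp ψ = rμ := by rw [hψ, comp_symm_comp_eq]
  have h12 : IsPAdicAvatarOf ι μ ((FramedRep.unitsContinuousMulEquivOfUnique (Fin 1) (PadicAlgCl p) :
      (PadicAlgCl p)ˣ →ₜ* GL (Fin 1) (PadicAlgCl p)).comp ψ) := by rwa [hre]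
  have h13 : ∀ σ, κ σ = 1 → ψ σ = 1 := (factorsThroughZp_unitsChar_iff κ ψ).1 (by rwa [hre])
  -- `ψ^N = 1` by rigidity of the avatar of `μ^N = 1`
  have hpowN : IsPAdicAvatarOf ι (μ ^ N) ((FramedRep.unitsContinuousMulEquivOfUnique (Fin 1) (PadicAlgCl p) :
      (PadicAlgCl p)ˣ →ₜ* GL (Fin 1) (PadicAlgCl p)).comp (ψ ^ N)) :=
    isPAdicAvatarOf_pow ι h12 hμ11 N
  rw [hμN] at hpowN
  have hψN : ∀ σ, ψ σ ^ N = 1 := by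
    intro σ
    have heq := eq_of_isPAdicAvatarOf ι (isPAdicAvatarOf_one (K := K) ι) hpowN
    have := DFunLike.congr_fun heq σ
    have h1σ : (1 : absoluteGaloisGroup K →ₜ* (PadicAlgCl p)ˣ) σ = 1 := rfl
    rw [ContinuousMonoidHom.coe_comp, ContinuousMonoidHom.coe_comp, Function.comp_apply,
      Function.comp_apply, ContinuousMonoidHom.pow_apply, h1σ] at this
    exact (FramedRep.unitsContinuousMulEquivOfUnique (Fin 1) (PadicAlgCl p)).injective this
  -- hence `ψ^{p^e} = 1`
  set k := N.factorization p with hk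
  have hψk : ∀ σ, ψ σ ^ (p ^ k) = 1 :=
    pow_ordProj_eq_one_of_factorsThroughZp κ ψ.toMonoidHom h13 hN0.ne' hψN
  -- and `μ^{p^e} = 1` by rigidity of the character
  refine ⟨k, ?_⟩
  have hpowk : IsPAdicAvatarOf ι (μ ^ (p ^ k)) ((FramedRep.unitsContinuousMulEquivOfUnique (Fin 1) (PadicAlgCl p) :
      (PadicAlgCl p)ˣ →ₜ* GL (Fin 1) (PadicAlgCl p)).comp (ψ ^ (p ^ k))) :=
    isPAdicAvatarOf_pow ι h12 hμ11 (p ^ k)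
  have hone : ψ ^ (p ^ k) = 1 := ContinuousMonoidHom.ext fun σ => by
    rw [ContinuousMonoidHom.pow_apply, hψk]; rfl
  rw [hone] at hpowk
  exact eq_of_isPAdicAvatarOf_of_isPAdicAvatarOf ι hpowk (isPAdicAvatarOf_one ι)
    (fun v hv => isUnramifiedAt_pow' (hμ11 v hv) _) (fun v _ => isUnramifiedAt_one' v)

end Summit.BirchSwinnertonDyer.Rank1Residual.X11b.Three.LambdaSupply

end
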